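import Summits.QuantumFields.BalabanUV.Beta.GAN24.SawtoothSlotCalculus

/-!
# `BalabanUV.Beta.GAN24.BackgroundPairSectorWardForm` — binder row G-an2-4 ∕ (CONV-C), row (C) at the levels `j ≥ 1`, CONTACT side; Part 9 of
# `GAN24/FourFaceGaugeSectors` (my g64 memo `C-CONTACT-SECTORS-v0.md` §7 (b)(c), leaf-06 g52's memo `C-LEVELS-GE1.md` §18 «the sawtooth-weight junction
# (finite `Tset` → bounded periodic `λ` by `LocStencil₂` locality; mine∕leaf-02)»): **THE BACKGROUND-PAIR SECTOR IN WARD-READY FORM** — the pure-gauge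
# sector `Sector_{01}(Y) = Σ_{r∈cell} Σ'_{u′} (dλ_κ)_κ(r)·(dλ_{κ′})_{κ′}(u′)·Σ'_{xz} Y κ r κ′ u′ x z` of a unit-covariant `LocStencil₂` table EQUALS the block
# sawtooth summed over ONE CELL of divergence sites against an2's first-slot divergence `divV`, the sawtooth GRADIENT staying on the free slot:
# `Sector_{01}(Y)(αβ) = Σ_{y₀∈cell} (y₀)_κ·Σ'_{v} (dλ_{κ′})_{κ′}(v)·Σ'_{xz} (divV (Y · · κ′ v) y₀)(x,z)_{αβ}` — NO infinite-support gauge weight is ever needed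

NOT IN PRINT; OUR BOOKKEEPING (G-an2-4 crux team (2), leaf prover `b2b-balaban-gan24-formalise-leaf-02`, gen 65; journal [LEAF02-G65-ONLINE] ∕ INTENT
I-leaf02-g65-2).  WHY.  Part 1 (`FourFaceGaugeSectors`, p367201 ✓) writes the comb member's four-face excess — the CONTACT side of p2's one-step charge law
(`T2RecChargeStepFourFace.zmode_succ_eq_fourFace`, criterion `T2RecChargeStep.zfreeSym_sourceB_iff`) — as the alternating sum of pure-gauge sectors and
kills the lonely ones; on the Wilson-charged patterns `(μ,μ;α,α)` the background pair `Sector_{01}` (both background slots contracted with the gradient of the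
block sawtooth `λ_μ(w) = w_μ % N`, `(dλ_μ)_μ(w) = 1 − N·[w_μ % N = N−1]`), the leg pair `Sector_{23}` and the quadruple survive (Part 2).  The background pair is
valued by an2's PER-SITE `hS₂` law of the next level's table (`WardLocusQuarticSite.siteLaw_T2RecAt_succ`, p366760 ✓: `cH′ • divV (T̃ · · κ′ u′) y₀ =
[S(κ′u′), diagK(½·legInd ρ′ y₀)] + residual(y₀)`, and its `λ`-weighted form `siteLaw_T2RecAt_succ_weighted` for a FINITELY supported weight `lam` on a finite
`Tset` of divergence sites).  The sector, however, carries the sawtooth gradient on BOTH background slots, one of them summed over the whole lattice: a naive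
summation by parts puts the PERIODIC sawtooth `λ_κ` — infinite support — on the divergence site, which the finite-`Tset` law does not cover (memo §7 (c)
proposed a box-exhaustion limit for it).  THIS FILE shows the limit is unnecessary: by the joint `N`-periodicity of the weights and the joint unit covariance of
the table's field–field block, WHICH of the two background slots runs over one cell and which over the lattice can be EXCHANGED
(`SawtoothSlotCalculus.sum_box_tsum_exchange`), so the summation by parts is done on a lattice-summed slot (`SawtoothSlotCalculus.tsum_sawGrad_mul_eq_tsum_saw_mul_div`:
only the `κ`-component of `dλ_κ` is non-zero, and it IS the sector's slot weight), and a second exchange moves the resulting sawtooth weight onto the CELL-summed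
divergence site: the weight an2's law needs is `lam y₀ = (y₀)_κ` on `Tset =` one cell — finite —, and the infinite sum sits on the passive second slot `(κ′, v)`
with the bounded weight `(dλ_{κ′})_{κ′}(v)`, where the per-site law holds pointwise anyway.  §7 performs the substitution for ANY per-site law of the `hS₂`
shape (generator `X y₀`, remainder `R y₀ v` displayed) and, for a diagonal generator `diagK (g y₀)`, evaluates the commutator's entries (`conjV_diagK_apply`):
the CONTACT value of the background pair is `Σ_{y₀∈cell} (y₀)_κ·Σ'_v (dλ_{κ′})_{κ′}(v)·Σ'_{xz} [S(κ′v)(x,z)_{αβ}·(g y₀ z β − g y₀ x α) + R y₀ v (x,z)_{αβ}]` — the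
junction with an2's law is the one-line instantiation `hlaw := siteLaw_T2RecAt_succ …` in the member's file (after Part 2 `FourFaceGaugeSectorsMember` p367398
lands: it supplies the covariance `member_ff_translate`), after which Part 4 `ResidualChargeLegAntisymm` (p367725 ✓) removes the residual from the leg-symmetrised
charge and leaf-06's L1′ values the commutator.

WHAT (generic `d`, `1 ≤ N`; `Y : Tab d` with `LocStencil₂ Y C δ`, `0 < δ`, ff block BLOCK-covariant — `Y κ (u+N•t) κ′ (u′+N•t) x z (inl α)(inl β) = shiftK (−N•t)
(Y κ u κ′ u′) x z (inl α)(inl β)`, the shape of p2's `T2RecChargeStep.member_translate`; Part 1's unit covariance `h1` is the special case —;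
`legSum_translate_block`, `legSum_divV_translate_block`; [folklore] composition BY NAME over
`SawtoothSlotCalculus`; 0 `def`, 0 cited facts, 0 `def … : Prop`, 0 sorry):
* §6 the three moves `bg_exchange₁` (cell → second slot), `bg_abel` (summation by parts on the lattice-summed first slot, cell by cell), `bg_exchange₂` (cell
  back onto the divergence site, sawtooth = coordinate there); **`bgSector_eq_sum_saw_divV`** — THE WARD-READY FORM with explicit weights:
  `Σ_{r∈box} Σ'_v (dλ_κ)_κ(toSite r)·(dλ_{κ′})_{κ′}(v)·Σ'_{xz} Y κ (toSite r) κ′ v x z (inl α)(inl β)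
   = Σ_{y₀∈box} (y₀)_κ·Σ'_v (dλ_{κ′})_{κ′}(v)·Σ'_{xz} divV (fun μ y ↦ Y μ y κ′ v) (toSite y₀) x z (inl α)(inl β)`;
  **`sector01_eq_sum_saw_divV`** — the same with Part 1's literal sector on the left (`Π_{s∈{0,1}} (1 − N·[slot_s (δ_s) % N = N−1])`, slots `![toSite r, u′, x, z]`,
  directions `![κ, κ′, a, b]`): verbatim the `S = {0,1}` term of `FourFaceGaugeSectors.fourFace_mul_eq_sum_sectors` ∕ Part 2's `fourFace_mul_eq_of_pairs_bg_leg`.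
* §7 **`sector01_eq_of_siteLaw`** — for ANY per-site law `cH • divV (fun μ y ↦ Y μ y κ′ v) y₀ = comp (S v) (X y₀) − comp (X y₀) (S v) + R y₀ v` (an2's `hS₂`
  shape), `cH·Sector_{01}(Y) = Σ_{y₀∈box} (y₀)_κ·Σ'_v (dλ_{κ′})_{κ′}(v)·Σ'_{xz} (comp (S v) (X y₀) − comp (X y₀) (S v) + R y₀ v)(x,z)_{αβ}` (`y₀ ↦ toSite y₀`);
  **`sector01_eq_of_siteLaw_diagK`** — diagonal generator `X y₀ = diagK (g y₀)`: the commutator entry is `S v x z (inl α)(inl β)·(g y₀ z (inl β) − g y₀ x (inl α))`.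
READING for (C)_j (docstring level): with `Y :=` the member `T̃_{j+1}`'s table and `hlaw := WardLocusQuarticSite.siteLaw_T2RecAt_succ` (second slot `(κ′, v)`,
generator `diagK (½ • legInd ρ′ y₀)`), §7 is the background-pair CONTACT sector at level `j+1` as [commutator charge weighted by the cell sawtooth] + [weighted
residual charges]; NOT asserted here.  HONEST FRAMING (cell contract, verbatim): «discharging `BetaPertH` makes Bałaban's UV stability UNCONDITIONAL — a real
constructive-QFT result; it is NOT the continuum limit and NOT the Clay problem.»  HONEST DEPENDENCY (verbatim): «continuum YM on T⁴ ⇐ BetaPertH ∧ nine spine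
estimates (0/9 proved); BetaPertH ⇐ (D1) ∧ (D4) ∧ CAP+tail; G-an2-4 gates asym, D1 and NE2/3/4.»  Bookkeeping only: NO Ward content (the law is a displayed
hypothesis of §7), NO estimate of Bałaban's; discharges NOTHING of (C) ∕ (C)sym ∕ (Q-L) ∕ «T2Shape» ∕ «T2Drift» ∕ (hW, hWall); 0 wall binders; NEVER «G-an2-4
closed» as (CONV-C); NOT D1, NOT BetaPertH, NOT continuum, NOT Clay.  2026-08-23.
-/

noncomputable section

open Finset
open scoped BigOperators
open Literature.MathematicalPhysics.QuantumFieldTheory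
open Literature.MathematicalPhysics.QuantumFieldTheory.Balaban1983to89
open Literature.MathematicalPhysics.QuantumFieldTheory.Balaban1983to89.Beta
open B6BondElimination (unitVec unitVec_apply)
open ExpKernelCalculus (MKer shiftK comp)
open KernelWard (divV)
open AffineAveraging (Site box toSite)
open OneStepResolventKernel (Fib)
open BalabanCompositeJets (LocStencil₂)
open Summit.QuantumFields.BalabanUV.Beta.BorderedHessian (diagK conjV_diagK_apply)
open Summit.QuantumFields.BalabanUV.Beta.ChartConjugation (conjV)
open Summit.QuantumFields.BalabanUV.Beta.GAN24.BiStencilZeroMode (Tab zmode)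
open Summit.QuantumFields.BalabanUV.Beta.GAN24.CoarseGaugeSourceResponse (summable_bdd_mul)
open Summit.QuantumFields.BalabanUV.Beta.GAN24.SawtoothSlotCalculus

namespace Summit.QuantumFields.BalabanUV.Beta.GAN24.BackgroundPairSectorWardForm

variable {d : ℕ} {N : ℕ}

/-! ## §6 The background-pair sector in Ward-ready form -/

/-- [folklore] Part A's `legSum_translate` under BLOCK covariance only (`N•ℤ^{d+1}` shifts of the field–field block — the hypothesis shape of p2's
`T2RecChargeStep.member_translate`; unit covariance (Part 2 ∕ Part 10) is the special case): the ff leg double sum is jointly `N`-periodic in the two bonds. -/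
theorem legSum_translate_block {Y : Tab d}
    (h1 : ∀ κ u κ' u' (t x z : Site (d + 1)) (α β : Fin (d + 1)),
      Y κ (u + (N : ℤ) • t) κ' (u' + (N : ℤ) • t) x z (Sum.inl α) (Sum.inl β) = shiftK (-((N : ℤ) • t)) (Y κ u κ' u') x z (Sum.inl α) (Sum.inl β))
    (κ : Fin (d + 1)) (u : Site (d + 1)) (κ' : Fin (d + 1)) (u' t : Site (d + 1)) (α β : Fin (d + 1)) :
    (∑' x : Site (d + 1), ∑' z : Site (d + 1), Y κ (u + (N : ℤ) • t) κ' (u' + (N : ℤ) • t) x z (Sum.inl α) (Sum.inl β))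
      = ∑' x : Site (d + 1), ∑' z : Site (d + 1), Y κ u κ' u' x z (Sum.inl α) (Sum.inl β) := by
  simp_rw [h1 κ u κ' u' t]
  exact tsum_tsum_shiftK (-((N : ℤ) • t)) (Y κ u κ' u') _ _

/-- [folklore] Part A's `legSum_divV_translate` under block covariance only. -/
theorem legSum_divV_translate_block {Y : Tab d} {C δ : ℝ} (hY : LocStencil₂ Y C δ) (hδ : 0 < δ)
    (h1 : ∀ κ u κ' u' (t x z : Site (d + 1)) (α β : Fin (d + 1)),
      Y κ (u + (N : ℤ) • t) κ' (u' + (N : ℤ) • t) x z (Sum.inl α) (Sum.inl β) = shiftK (-((N : ℤ) • t)) (Y κ u κ' u') x z (Sum.inl α) (Sum.inl β))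
    (κ' : Fin (d + 1)) (v y₀ t : Site (d + 1)) (α β : Fin (d + 1)) :
    (∑' x : Site (d + 1), ∑' z : Site (d + 1), divV (fun μ y => Y μ y κ' (v + (N : ℤ) • t)) (y₀ + (N : ℤ) • t) x z (Sum.inl α) (Sum.inl β))
      = ∑' x : Site (d + 1), ∑' z : Site (d + 1), divV (fun μ y => Y μ y κ' v) y₀ x z (Sum.inl α) (Sum.inl β) := by
  rw [legSum_divV_eq hY hδ κ' (v + (N : ℤ) • t) (y₀ + (N : ℤ) • t), legSum_divV_eq hY hδ κ' v y₀]
  refine Finset.sum_congr rfl fun μ _ => ?_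
  rw [show y₀ + (N : ℤ) • t - unitVec μ = (y₀ - unitVec μ) + (N : ℤ) • t from by abel, legSum_translate_block h1, legSum_translate_block h1]

/-- [folklore] STEP 1 — THE FIRST EXCHANGE: the cell moves from the first background slot to the second (`sum_box_tsum_exchange` for
`F u v = (1 − N·[u_κ % N = N−1])·(1 − N·[v_{κ′} % N = N−1])·Σ'_{xz} Y κ u κ′ v x z (inl α)(inl β)`, jointly `N`-periodic by §1 + `legSum_translate`). -/
theorem bg_exchange₁ [NeZero N] {Y : Tab d} {C δ : ℝ} (hY : LocStencil₂ Y C δ) (hδ : 0 < δ)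
    (h1 : ∀ κ u κ' u' (t x z : Site (d + 1)) (α β : Fin (d + 1)),
      Y κ (u + (N : ℤ) • t) κ' (u' + (N : ℤ) • t) x z (Sum.inl α) (Sum.inl β) = shiftK (-((N : ℤ) • t)) (Y κ u κ' u') x z (Sum.inl α) (Sum.inl β))
    (κ κ' α β : Fin (d + 1)) :
    ∑ rr ∈ box (d + 1) N, ∑' v : Site (d + 1),
        (1 - (N : ℝ) * (if toSite rr κ % (N : ℤ) = (N : ℤ) - 1 then (1 : ℝ) else 0))
          * (1 - (N : ℝ) * (if v κ' % (N : ℤ) = (N : ℤ) - 1 then (1 : ℝ) else 0))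
          * ∑' x : Site (d + 1), ∑' z : Site (d + 1), Y κ (toSite rr) κ' v x z (Sum.inl α) (Sum.inl β)
      = ∑ vv ∈ box (d + 1) N, (1 - (N : ℝ) * (if toSite vv κ' % (N : ℤ) = (N : ℤ) - 1 then (1 : ℝ) else 0))
          * ∑' u : Site (d + 1), (1 - (N : ℝ) * (if u κ % (N : ℤ) = (N : ℤ) - 1 then (1 : ℝ) else 0))
            * ∑' x : Site (d + 1), ∑' z : Site (d + 1), Y κ u κ' (toSite vv) x z (Sum.inl α) (Sum.inl β) := by
  have hper : ∀ u v t : Site (d + 1),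
      (1 - (N : ℝ) * (if (u + (N : ℤ) • t) κ % (N : ℤ) = (N : ℤ) - 1 then (1 : ℝ) else 0))
        * (1 - (N : ℝ) * (if (v + (N : ℤ) • t) κ' % (N : ℤ) = (N : ℤ) - 1 then (1 : ℝ) else 0))
        * (∑' x : Site (d + 1), ∑' z : Site (d + 1), Y κ (u + (N : ℤ) • t) κ' (v + (N : ℤ) • t) x z (Sum.inl α) (Sum.inl β))
      = (1 - (N : ℝ) * (if u κ % (N : ℤ) = (N : ℤ) - 1 then (1 : ℝ) else 0))
        * (1 - (N : ℝ) * (if v κ' % (N : ℤ) = (N : ℤ) - 1 then (1 : ℝ) else 0))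
        * (∑' x : Site (d + 1), ∑' z : Site (d + 1), Y κ u κ' v x z (Sum.inl α) (Sum.inl β)) := by
    intro u v t
    rw [emod_add_zsmul_apply, emod_add_zsmul_apply, legSum_translate_block h1]
  have hs1 : ∀ rr ∈ box (d + 1) N, Summable fun v : Site (d + 1) =>
      (1 - (N : ℝ) * (if toSite rr κ % (N : ℤ) = (N : ℤ) - 1 then (1 : ℝ) else 0))
        * (1 - (N : ℝ) * (if v κ' % (N : ℤ) = (N : ℤ) - 1 then (1 : ℝ) else 0))
        * ∑' x : Site (d + 1), ∑' z : Site (d + 1), Y κ (toSite rr) κ' v x z (Sum.inl α) (Sum.inl β) := fun rr _ =>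
    ((summable_bdd_mul (summable_legSum_snd hY hδ κ (toSite rr) κ' (Sum.inl α) (Sum.inl β)) (fun v => abs_sawGrad_le N (v κ'))).mul_left
      (1 - (N : ℝ) * (if toSite rr κ % (N : ℤ) = (N : ℤ) - 1 then (1 : ℝ) else 0))).congr fun v => (mul_assoc _ _ _).symm
  have hs2 : ∀ vv ∈ box (d + 1) N, Summable fun u : Site (d + 1) =>
      (1 - (N : ℝ) * (if u κ % (N : ℤ) = (N : ℤ) - 1 then (1 : ℝ) else 0))
        * (1 - (N : ℝ) * (if toSite vv κ' % (N : ℤ) = (N : ℤ) - 1 then (1 : ℝ) else 0))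
        * ∑' x : Site (d + 1), ∑' z : Site (d + 1), Y κ u κ' (toSite vv) x z (Sum.inl α) (Sum.inl β) := fun vv _ =>
    ((summable_bdd_mul (summable_legSum_fst hY hδ κ κ' (toSite vv) (Sum.inl α) (Sum.inl β)) (fun u => abs_sawGrad_le N (u κ))).mul_left
      (1 - (N : ℝ) * (if toSite vv κ' % (N : ℤ) = (N : ℤ) - 1 then (1 : ℝ) else 0))).congr fun u => by ring
  have hx := sum_box_tsum_exchange (N := N) (fun u v : Site (d + 1) =>
      (1 - (N : ℝ) * (if u κ % (N : ℤ) = (N : ℤ) - 1 then (1 : ℝ) else 0))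
        * (1 - (N : ℝ) * (if v κ' % (N : ℤ) = (N : ℤ) - 1 then (1 : ℝ) else 0))
        * ∑' x : Site (d + 1), ∑' z : Site (d + 1), Y κ u κ' v x z (Sum.inl α) (Sum.inl β)) hper hs1 hs2
  beta_reduce at hx
  rw [hx]
  refine Finset.sum_congr rfl fun vv _ => ?_
  rw [← tsum_mul_left]
  exact tsum_congr fun u => by ring

/-- [folklore] STEP 2 — SUMMATION BY PARTS ON THE LATTICE-SUMMED FIRST SLOT (§2 with the columns `c μ u = Σ'_{xz} Y μ u κ′ v x z (inl α)(inl β)`, then §5):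
`Σ'_u (1 − N·[u_κ % N = N−1])·Σ'_{xz} Y κ u κ′ v x z = Σ'_u λ(u_κ)·Σ'_{xz} divV (fun μ y ↦ Y μ y κ′ v) u x z`. -/
theorem bg_abel (hN : 1 ≤ N) {Y : Tab d} {C δ : ℝ} (hY : LocStencil₂ Y C δ) (hδ : 0 < δ) (κ κ' : Fin (d + 1)) (v : Site (d + 1))
    (α β : Fin (d + 1)) :
    ∑' u : Site (d + 1), (1 - (N : ℝ) * (if u κ % (N : ℤ) = (N : ℤ) - 1 then (1 : ℝ) else 0))
        * ∑' x : Site (d + 1), ∑' z : Site (d + 1), Y κ u κ' v x z (Sum.inl α) (Sum.inl β)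
      = ∑' u : Site (d + 1), (((u κ % (N : ℤ)) : ℤ) : ℝ)
        * ∑' x : Site (d + 1), ∑' z : Site (d + 1), divV (fun μ y => Y μ y κ' v) u x z (Sum.inl α) (Sum.inl β) := by
  have hc : ∀ μ : Fin (d + 1), Summable fun u : Site (d + 1) =>
      ∑' x : Site (d + 1), ∑' z : Site (d + 1), Y μ u κ' v x z (Sum.inl α) (Sum.inl β) :=
    fun μ => summable_legSum_fst hY hδ μ κ' v (Sum.inl α) (Sum.inl β)
  have hab := tsum_sawGrad_mul_eq_tsum_saw_mul_div hN
    (fun μ u => ∑' x : Site (d + 1), ∑' z : Site (d + 1), Y μ u κ' v x z (Sum.inl α) (Sum.inl β)) hc κ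
  beta_reduce at hab
  rw [hab]
  refine tsum_congr fun u => ?_
  rw [legSum_divV_eq hY hδ κ' v u]

/-- [folklore] STEP 3 — THE SECOND EXCHANGE: the cell moves back onto the divergence site, where the sawtooth is the coordinate (`sum_box_tsum_exchange` for
`F′ u v = λ(u_κ)·(1 − N·[v_{κ′} % N = N−1])·Σ'_{xz} divV (fun μ y ↦ Y μ y κ′ v) u x z (inl α)(inl β)`, jointly `N`-periodic by §1 + `legSum_divV_translate`). -/
theorem bg_exchange₂ [NeZero N] {Y : Tab d} {C δ : ℝ} (hY : LocStencil₂ Y C δ) (hδ : 0 < δ)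
    (h1 : ∀ κ u κ' u' (t x z : Site (d + 1)) (α β : Fin (d + 1)),
      Y κ (u + (N : ℤ) • t) κ' (u' + (N : ℤ) • t) x z (Sum.inl α) (Sum.inl β) = shiftK (-((N : ℤ) • t)) (Y κ u κ' u') x z (Sum.inl α) (Sum.inl β))
    (κ κ' α β : Fin (d + 1)) :
    ∑ vv ∈ box (d + 1) N, (1 - (N : ℝ) * (if toSite vv κ' % (N : ℤ) = (N : ℤ) - 1 then (1 : ℝ) else 0))
        * ∑' u : Site (d + 1), (((u κ % (N : ℤ)) : ℤ) : ℝ)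
          * ∑' x : Site (d + 1), ∑' z : Site (d + 1), divV (fun μ y => Y μ y κ' (toSite vv)) u x z (Sum.inl α) (Sum.inl β)
      = ∑ yy ∈ box (d + 1) N, ((yy κ : ℕ) : ℝ) * ∑' v : Site (d + 1),
          (1 - (N : ℝ) * (if v κ' % (N : ℤ) = (N : ℤ) - 1 then (1 : ℝ) else 0))
            * ∑' x : Site (d + 1), ∑' z : Site (d + 1), divV (fun μ y => Y μ y κ' v) (toSite yy) x z (Sum.inl α) (Sum.inl β) := by
  have hN : 1 ≤ N := Nat.one_le_iff_ne_zero.mpr (NeZero.ne N)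
  have hper : ∀ u v t : Site (d + 1),
      ((((u + (N : ℤ) • t) κ % (N : ℤ)) : ℤ) : ℝ)
        * (1 - (N : ℝ) * (if (v + (N : ℤ) • t) κ' % (N : ℤ) = (N : ℤ) - 1 then (1 : ℝ) else 0))
        * (∑' x : Site (d + 1), ∑' z : Site (d + 1), divV (fun μ y => Y μ y κ' (v + (N : ℤ) • t)) (u + (N : ℤ) • t) x z (Sum.inl α) (Sum.inl β))
      = (((u κ % (N : ℤ)) : ℤ) : ℝ)
        * (1 - (N : ℝ) * (if v κ' % (N : ℤ) = (N : ℤ) - 1 then (1 : ℝ) else 0))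
        * (∑' x : Site (d + 1), ∑' z : Site (d + 1), divV (fun μ y => Y μ y κ' v) u x z (Sum.inl α) (Sum.inl β)) := by
    intro u v t
    rw [emod_add_zsmul_apply, emod_add_zsmul_apply, legSum_divV_translate_block hY hδ h1]
  have hs1 : ∀ rr ∈ box (d + 1) N, Summable fun v : Site (d + 1) =>
      (((toSite rr κ % (N : ℤ)) : ℤ) : ℝ)
        * (1 - (N : ℝ) * (if v κ' % (N : ℤ) = (N : ℤ) - 1 then (1 : ℝ) else 0))
        * ∑' x : Site (d + 1), ∑' z : Site (d + 1), divV (fun μ y => Y μ y κ' v) (toSite rr) x z (Sum.inl α) (Sum.inl β) := fun rr _ =>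
    ((summable_bdd_mul (summable_legSum_divV_snd hY hδ κ' (toSite rr) (Sum.inl α) (Sum.inl β)) (fun v => abs_sawGrad_le N (v κ'))).mul_left
      (((toSite rr κ % (N : ℤ)) : ℤ) : ℝ)).congr fun v => (mul_assoc _ _ _).symm
  have hs2 : ∀ vv ∈ box (d + 1) N, Summable fun u : Site (d + 1) =>
      (((u κ % (N : ℤ)) : ℤ) : ℝ)
        * (1 - (N : ℝ) * (if toSite vv κ' % (N : ℤ) = (N : ℤ) - 1 then (1 : ℝ) else 0))
        * ∑' x : Site (d + 1), ∑' z : Site (d + 1), divV (fun μ y => Y μ y κ' (toSite vv)) u x z (Sum.inl α) (Sum.inl β) := fun vv _ =>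
    ((summable_bdd_mul (summable_legSum_divV_fst hY hδ κ' (toSite vv) (Sum.inl α) (Sum.inl β)) (fun u => abs_saw_le hN (u κ))).mul_left
      (1 - (N : ℝ) * (if toSite vv κ' % (N : ℤ) = (N : ℤ) - 1 then (1 : ℝ) else 0))).congr fun u => by ring
  have hx := sum_box_tsum_exchange (N := N) (fun u v : Site (d + 1) =>
      (((u κ % (N : ℤ)) : ℤ) : ℝ)
        * (1 - (N : ℝ) * (if v κ' % (N : ℤ) = (N : ℤ) - 1 then (1 : ℝ) else 0))
        * ∑' x : Site (d + 1), ∑' z : Site (d + 1), divV (fun μ y => Y μ y κ' v) u x z (Sum.inl α) (Sum.inl β)) hper hs1 hs2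
  beta_reduce at hx
  -- the left side is `Σ_vv Σ'_u F′ u (toSite vv)`
  have eL : ∀ vv : Fin (d + 1) → ℕ, (1 - (N : ℝ) * (if toSite vv κ' % (N : ℤ) = (N : ℤ) - 1 then (1 : ℝ) else 0))
        * (∑' u : Site (d + 1), (((u κ % (N : ℤ)) : ℤ) : ℝ)
          * ∑' x : Site (d + 1), ∑' z : Site (d + 1), divV (fun μ y => Y μ y κ' (toSite vv)) u x z (Sum.inl α) (Sum.inl β))
      = ∑' u : Site (d + 1), (((u κ % (N : ℤ)) : ℤ) : ℝ)
          * (1 - (N : ℝ) * (if toSite vv κ' % (N : ℤ) = (N : ℤ) - 1 then (1 : ℝ) else 0))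
          * ∑' x : Site (d + 1), ∑' z : Site (d + 1), divV (fun μ y => Y μ y κ' (toSite vv)) u x z (Sum.inl α) (Sum.inl β) := by
    intro vv
    rw [← tsum_mul_left]
    exact tsum_congr fun u => by ring
  rw [Finset.sum_congr rfl fun vv _ => eL vv, ← hx]
  -- read off: the sawtooth at an in-cell site is the coordinate
  refine Finset.sum_congr rfl fun yy hyy => ?_
  rw [← tsum_mul_left]
  refine tsum_congr fun v => ?_
  rw [toSite_emod_of_mem_box hyy, Int.cast_natCast, mul_assoc]

/-- NOT IN PRINT; OUR BOOKKEEPING.  **THE BACKGROUND-PAIR SECTOR IN WARD-READY FORM** (explicit weights; `1 ≤ N`, `LocStencil₂ Y C δ`, `0 < δ`, ff block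
unit-covariant; first slot direction `κ` over one cell, second slot `(κ′, v)` over the lattice):
`Σ_{r∈box N} Σ'_v (1 − N·[r_κ % N = N−1])·(1 − N·[v_{κ′} % N = N−1])·Σ'_{xz} Y κ (toSite r) κ′ v x z (inl α)(inl β)
 = Σ_{y₀∈box N} (y₀)_κ·Σ'_v (1 − N·[v_{κ′} % N = N−1])·Σ'_{xz} divV (fun μ y ↦ Y μ y κ′ v) (toSite y₀) x z (inl α)(inl β)`
— exchange (STEP 1), summation by parts on the now lattice-summed first slot (STEP 2), exchange back (STEP 3): the block sawtooth lands on the CELL-summed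
divergence site, with the finite weight `(y₀)_κ`. -/
theorem bgSector_eq_sum_saw_divV (hN : 1 ≤ N) {Y : Tab d} {C δ : ℝ} (hY : LocStencil₂ Y C δ) (hδ : 0 < δ)
    (h1 : ∀ κ u κ' u' (t x z : Site (d + 1)) (α β : Fin (d + 1)),
      Y κ (u + (N : ℤ) • t) κ' (u' + (N : ℤ) • t) x z (Sum.inl α) (Sum.inl β) = shiftK (-((N : ℤ) • t)) (Y κ u κ' u') x z (Sum.inl α) (Sum.inl β))
    (κ κ' α β : Fin (d + 1)) :
    ∑ rr ∈ box (d + 1) N, ∑' v : Site (d + 1),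
        (1 - (N : ℝ) * (if toSite rr κ % (N : ℤ) = (N : ℤ) - 1 then (1 : ℝ) else 0))
          * (1 - (N : ℝ) * (if v κ' % (N : ℤ) = (N : ℤ) - 1 then (1 : ℝ) else 0))
          * ∑' x : Site (d + 1), ∑' z : Site (d + 1), Y κ (toSite rr) κ' v x z (Sum.inl α) (Sum.inl β)
      = ∑ yy ∈ box (d + 1) N, ((yy κ : ℕ) : ℝ) * ∑' v : Site (d + 1),
          (1 - (N : ℝ) * (if v κ' % (N : ℤ) = (N : ℤ) - 1 then (1 : ℝ) else 0))
            * ∑' x : Site (d + 1), ∑' z : Site (d + 1), divV (fun μ y => Y μ y κ' v) (toSite yy) x z (Sum.inl α) (Sum.inl β) := by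
  haveI : NeZero N := ⟨by omega⟩
  rw [bg_exchange₁ hY hδ h1 κ κ' α β, Finset.sum_congr rfl fun vv _ => by rw [bg_abel hN hY hδ κ κ' (toSite vv) α β]]
  exact bg_exchange₂ hY hδ h1 κ κ' α β

/-- NOT IN PRINT; OUR BOOKKEEPING.  **THE BACKGROUND-PAIR SECTOR `Sector_{01}` OF PART 1 IN WARD-READY FORM** — Part 1's literal sector term for `S = {0,1}`
(directions `![κ, κ′, a, b]`, slots `![toSite r, u′, x, z]`; verbatim the `{0,1}` term of `FourFaceGaugeSectors.fourFace_mul_eq_sum_sectors` and of Part 2's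
`fourFace_mul_eq_of_pairs_bg_leg` at `κ′ = κ`):
`Sector_{01}(Y)(κ,κ′;a,b)(αβ) = Σ_{y₀∈box N} (y₀)_κ·Σ'_v (1 − N·[v_{κ′} % N = N−1])·Σ'_{xz} divV (fun μ y ↦ Y μ y κ′ v) (toSite y₀) x z (inl α)(inl β)`. -/
theorem sector01_eq_sum_saw_divV (hN : 1 ≤ N) {Y : Tab d} {C δ : ℝ} (hY : LocStencil₂ Y C δ) (hδ : 0 < δ)
    (h1 : ∀ κ u κ' u' (t x z : Site (d + 1)) (α β : Fin (d + 1)),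
      Y κ (u + (N : ℤ) • t) κ' (u' + (N : ℤ) • t) x z (Sum.inl α) (Sum.inl β) = shiftK (-((N : ℤ) • t)) (Y κ u κ' u') x z (Sum.inl α) (Sum.inl β))
    (κ κ' a b α β : Fin (d + 1)) :
    ∑ rr ∈ box (d + 1) N, ∑' u' : Site (d + 1), ∑' x : Site (d + 1), ∑' z : Site (d + 1),
        (∏ s ∈ ({0, 1} : Finset (Fin 4)), (1 - (N : ℝ) * (if (![toSite rr, u', x, z] : Fin 4 → Site (d + 1)) s
            ((![κ, κ', a, b] : Fin 4 → Fin (d + 1)) s) % (N : ℤ) = (N : ℤ) - 1 then (1 : ℝ) else 0)))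
          * Y κ (toSite rr) κ' u' x z (Sum.inl α) (Sum.inl β)
      = ∑ yy ∈ box (d + 1) N, ((yy κ : ℕ) : ℝ) * ∑' v : Site (d + 1),
          (1 - (N : ℝ) * (if v κ' % (N : ℤ) = (N : ℤ) - 1 then (1 : ℝ) else 0))
            * ∑' x : Site (d + 1), ∑' z : Site (d + 1), divV (fun μ y => Y μ y κ' v) (toSite yy) x z (Sum.inl α) (Sum.inl β) := by
  have h01 : (0 : Fin 4) ≠ 1 := by decide
  have eP : ∀ (rr : Fin (d + 1) → ℕ) (u' x z : Site (d + 1)),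
      (∏ s ∈ ({0, 1} : Finset (Fin 4)), (1 - (N : ℝ) * (if (![toSite rr, u', x, z] : Fin 4 → Site (d + 1)) s
          ((![κ, κ', a, b] : Fin 4 → Fin (d + 1)) s) % (N : ℤ) = (N : ℤ) - 1 then (1 : ℝ) else 0)))
        = (1 - (N : ℝ) * (if toSite rr κ % (N : ℤ) = (N : ℤ) - 1 then (1 : ℝ) else 0))
          * (1 - (N : ℝ) * (if u' κ' % (N : ℤ) = (N : ℤ) - 1 then (1 : ℝ) else 0)) := by
    intro rr u' x z
    rw [Finset.prod_pair h01]
    rfl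
  simp_rw [eP]
  simp_rw [tsum_mul_left]
  exact bgSector_eq_sum_saw_divV hN hY hδ h1 κ κ' α β

/-! ## §7 Substituting a per-site law of the `hS₂` shape -/

/-- NOT IN PRINT; OUR BOOKKEEPING.  **THE BACKGROUND-PAIR SECTOR UNDER A PER-SITE LAW** (an2's `hS₂` shape — `WardLocusQuarticSite.siteLaw_T2RecAt_succ` is
the instance —: for every divergence site `y₀` and passive bond `(κ′, v)`, `cH • divV (fun μ y ↦ Y μ y κ′ v) y₀ = comp (S v) (X y₀) − comp (X y₀) (S v) + R y₀ v`,
generator `X y₀` and remainder `R y₀ v` DISPLAYED):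
`cH·Sector_{01}(Y)(κ,κ′;a,b)(αβ) = Σ_{y₀∈box N} (y₀)_κ·Σ'_v (1 − N·[v_{κ′} % N = N−1])·Σ'_{xz} (comp (S v) (X (toSite y₀)) − comp (X (toSite y₀)) (S v) + R (toSite y₀) v) x z (inl α)(inl β)`. -/
theorem sector01_eq_of_siteLaw (hN : 1 ≤ N) {Y : Tab d} {C δ : ℝ} (hY : LocStencil₂ Y C δ) (hδ : 0 < δ)
    (h1 : ∀ κ u κ' u' (t x z : Site (d + 1)) (α β : Fin (d + 1)),
      Y κ (u + (N : ℤ) • t) κ' (u' + (N : ℤ) • t) x z (Sum.inl α) (Sum.inl β) = shiftK (-((N : ℤ) • t)) (Y κ u κ' u') x z (Sum.inl α) (Sum.inl β))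
    (κ κ' a b α β : Fin (d + 1)) {cH : ℝ} {S : Site (d + 1) → MKer (d + 1) (Fib d)} {X : Site (d + 1) → MKer (d + 1) (Fib d)}
    {R : Site (d + 1) → Site (d + 1) → MKer (d + 1) (Fib d)}
    (hlaw : ∀ y₀ v : Site (d + 1), cH • divV (fun μ y => Y μ y κ' v) y₀ = comp (S v) (X y₀) - comp (X y₀) (S v) + R y₀ v) :
    cH * ∑ rr ∈ box (d + 1) N, ∑' u' : Site (d + 1), ∑' x : Site (d + 1), ∑' z : Site (d + 1),
        (∏ s ∈ ({0, 1} : Finset (Fin 4)), (1 - (N : ℝ) * (if (![toSite rr, u', x, z] : Fin 4 → Site (d + 1)) s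
            ((![κ, κ', a, b] : Fin 4 → Fin (d + 1)) s) % (N : ℤ) = (N : ℤ) - 1 then (1 : ℝ) else 0)))
          * Y κ (toSite rr) κ' u' x z (Sum.inl α) (Sum.inl β)
      = ∑ yy ∈ box (d + 1) N, ((yy κ : ℕ) : ℝ) * ∑' v : Site (d + 1),
          (1 - (N : ℝ) * (if v κ' % (N : ℤ) = (N : ℤ) - 1 then (1 : ℝ) else 0))
            * ∑' x : Site (d + 1), ∑' z : Site (d + 1),
                (comp (S v) (X (toSite yy)) - comp (X (toSite yy)) (S v) + R (toSite yy) v) x z (Sum.inl α) (Sum.inl β) := by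
  rw [sector01_eq_sum_saw_divV hN hY hδ h1 κ κ' a b α β, Finset.mul_sum]
  refine Finset.sum_congr rfl fun yy _ => ?_
  rw [mul_left_comm, ← tsum_mul_left]
  congr 1
  refine tsum_congr fun v => ?_
  rw [mul_left_comm, ← tsum_mul_left]
  congr 1
  refine tsum_congr fun x => ?_
  rw [← tsum_mul_left]
  refine tsum_congr fun z => ?_
  have h := congrFun (congrFun (congrFun (congrFun (hlaw (toSite yy) v) x) z) (Sum.inl α)) (Sum.inl β)
  rw [Pi.smul_apply, Pi.smul_apply, Pi.smul_apply, Pi.smul_apply, smul_eq_mul] at h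
  exact h

/-- NOT IN PRINT; OUR BOOKKEEPING.  **THE SAME WITH A DIAGONAL GENERATOR** (`X y₀ = diagK (g y₀)` — an2's `diagK (½ • legInd ρ′ y₀)`, or the weighted
`diagK (½ • Σ_{y₀∈T} lam y₀ • legInd ρ′ y₀)`): the commutator's entry is `S v x z (inl α)(inl β)·(g y₀ z (inl β) − g y₀ x (inl α))` (`conjV_diagK_apply`), so
`cH·Sector_{01}(Y)(αβ) = Σ_{y₀∈box N} (y₀)_κ·Σ'_v (1 − N·[v_{κ′} % N = N−1])·Σ'_{xz} (S v x z (inl α)(inl β)·(g (toSite y₀) z (inl β) − g (toSite y₀) x (inl α))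
+ R (toSite y₀) v x z (inl α)(inl β))` — THE CONTACT VALUE OF THE BACKGROUND PAIR: the cell sawtooth against the commutator charge, plus the weighted residual charges. -/
theorem sector01_eq_of_siteLaw_diagK (hN : 1 ≤ N) {Y : Tab d} {C δ : ℝ} (hY : LocStencil₂ Y C δ) (hδ : 0 < δ)
    (h1 : ∀ κ u κ' u' (t x z : Site (d + 1)) (α β : Fin (d + 1)),
      Y κ (u + (N : ℤ) • t) κ' (u' + (N : ℤ) • t) x z (Sum.inl α) (Sum.inl β) = shiftK (-((N : ℤ) • t)) (Y κ u κ' u') x z (Sum.inl α) (Sum.inl β))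
    (κ κ' a b α β : Fin (d + 1)) {cH : ℝ} {S : Site (d + 1) → MKer (d + 1) (Fib d)} {g : Site (d + 1) → Site (d + 1) → Fib d → ℝ}
    {R : Site (d + 1) → Site (d + 1) → MKer (d + 1) (Fib d)}
    (hlaw : ∀ y₀ v : Site (d + 1), cH • divV (fun μ y => Y μ y κ' v) y₀ = comp (S v) (diagK (g y₀)) - comp (diagK (g y₀)) (S v) + R y₀ v) :
    cH * ∑ rr ∈ box (d + 1) N, ∑' u' : Site (d + 1), ∑' x : Site (d + 1), ∑' z : Site (d + 1),
        (∏ s ∈ ({0, 1} : Finset (Fin 4)), (1 - (N : ℝ) * (if (![toSite rr, u', x, z] : Fin 4 → Site (d + 1)) s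
            ((![κ, κ', a, b] : Fin 4 → Fin (d + 1)) s) % (N : ℤ) = (N : ℤ) - 1 then (1 : ℝ) else 0)))
          * Y κ (toSite rr) κ' u' x z (Sum.inl α) (Sum.inl β)
      = ∑ yy ∈ box (d + 1) N, ((yy κ : ℕ) : ℝ) * ∑' v : Site (d + 1),
          (1 - (N : ℝ) * (if v κ' % (N : ℤ) = (N : ℤ) - 1 then (1 : ℝ) else 0))
            * ∑' x : Site (d + 1), ∑' z : Site (d + 1),
                (S v x z (Sum.inl α) (Sum.inl β) * (g (toSite yy) z (Sum.inl β) - g (toSite yy) x (Sum.inl α))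
                  + R (toSite yy) v x z (Sum.inl α) (Sum.inl β)) := by
  rw [sector01_eq_of_siteLaw hN hY hδ h1 κ κ' a b α β hlaw]
  refine Finset.sum_congr rfl fun yy _ => ?_
  congr 1
  refine tsum_congr fun v => ?_
  congr 1
  refine tsum_congr fun x => tsum_congr fun z => ?_
  have hc : (comp (S v) (diagK (g (toSite yy))) - comp (diagK (g (toSite yy))) (S v)) x z (Sum.inl α) (Sum.inl β)
      = S v x z (Sum.inl α) (Sum.inl β) * (g (toSite yy) z (Sum.inl β) - g (toSite yy) x (Sum.inl α)) := by
    have h := conjV_diagK_apply (g (toSite yy)) (S v) x z (Sum.inl α) (Sum.inl β)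
    simpa only [ChartConjugation.conjV] using h
  rw [Pi.add_apply, Pi.add_apply, Pi.add_apply, Pi.add_apply, hc]

end Summit.QuantumFields.BalabanUV.Beta.GAN24.BackgroundPairSectorWardForm

end
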